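import Summits.AtomisticToContinuum.FouriersLaw.Theorems.BondHeatUncertaintySubdiffusiveBondHeatSiteEnergyCurrentCovariance

/-!
# Gibbs statics of the pinned chain, I: momentum parity and Gaussian integration by parts

Helper file (`--supports stmt-AtomisticToContinuum-12699`, route `HonestZwanzig`, decl `ParityStatics`).

Lebesgue integrals against the Gibbs density `ρ_T = e^{-H/T}` of `pinnedChain ω₂ lam β γ`
(`OscillatorChain.gibbsDensity`; the Gibbs measure is `Z⁻¹ ρ_T dq dp`,
`OscillatorChain.integral_gibbsMeasure`):

* parity: `∫ J ρ = 0` and `∫ E J ρ = 0` for `E` even and `J` odd under momentum reversal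
  (`pinnedChain_integral_odd_mul_gibbsDensity`, `pinnedChain_integral_even_mul_odd_mul_gibbsDensity`;
  no integrability needed); the divergence of the bond currents
  `D_y = ∑_b ([y = b+1] j_b - [b = y] j_b)` is odd and the route's split site energy
  `e_y = p_y²/2 + U(q_y) + ∑_j ([j = y+1] V(q_j - q_y)/2 + [y = j+1] V(q_y - q_j)/2)` (verbatim as in
  `Summit.AtomisticToContinuum.FouriersLaw.Theses.HonestZwanzig.ParityStatics`) is even;
* Gaussian integration by parts in ONE momentum: for a continuous `F` with `|F| ≤ C(1+H)` that does
  not depend on `p_i`, `∫ F p_i² ρ = T ∫ F ρ` (`pinnedChain_integral_indep_sq_momentum_mul_gibbsDensity`,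
  generalising `SubdiffusiveBondHeat.pinnedChain_integral_posObs_sq_momentum_mul_gibbsDensity`):
  under the Gibbs state `p_i ~ N(0, T)` independently of the other coordinates;
* two bookkeeping identities (`offDiagonal_combination`, `mean_combination`) used with
  `SubdiffusiveBondHeat.integral_siteEnergy_combination` to assemble the covariances
  `Cov(e_x, L e_y)` of the route.

Sources: Bonetto–Lebowitz–Rey-Bellet 2000 §4.1, §5.2; Chu–Li 2019 §3 (parity-vanishing Markovian
term). All folklore Gaussian calculus; nothing here closes an item.
-/

noncomputable section

open MeasureTheory

namespace Summit.AtomisticToContinuum.FouriersLaw.Theorems.HonestZwanzig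

open Literature.MathematicalPhysics.KineticTheory.HeatConduction
open Summit.AtomisticToContinuum.FouriersLaw.Theorems.SubdiffusiveBondHeat

variable {N : ℕ}

/-! ### Bookkeeping -/

/-- Off-diagonal bookkeeping: if `∫ e·j·ρ = 0` and `∫ e p₂ ρ = T ∫ e ρ` (all integrands integrable),
then `∫ e (j + c (T - p₂)) ρ = 0`. [folklore] -/
theorem offDiagonal_combination {α : Type*} [MeasurableSpace α] {μ : Measure α}
    {e jb ρ p2 : α → ℝ} {c T : ℝ}
    (f1i : Integrable (fun x => e x * jb x * ρ x) μ) (f1z : ∫ x, e x * jb x * ρ x ∂μ = 0)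
    (f4i : Integrable (fun x => e x * ρ x) μ) (f5i : Integrable (fun x => e x * p2 x * ρ x) μ)
    (hIBP : ∫ x, e x * p2 x * ρ x ∂μ = T * ∫ x, e x * ρ x ∂μ) :
    ∫ x, e x * (jb x + c * (T - p2 x)) * ρ x ∂μ = 0 := by
  have key : ∀ x, e x * (jb x + c * (T - p2 x)) * ρ x =
      e x * jb x * ρ x + c * T * (e x * ρ x) - c * (e x * p2 x * ρ x) := by
    intro x; ring
  have hA : Integrable (fun x => e x * jb x * ρ x + c * T * (e x * ρ x)) μ :=
    f1i.add (f4i.const_mul _)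
  rw [integral_congr_ae (Filter.Eventually.of_forall key),
    integral_sub hA (f5i.const_mul _), integral_add f1i (f4i.const_mul _),
    integral_const_mul, integral_const_mul, f1z, hIBP]
  ring

/-- Mean bookkeeping: if `∫ j ρ = 0` and `∫ p₂ ρ = T ∫ ρ` (integrands integrable), then
`∫ (j + c (T - p₂)) ρ = 0`. [folklore] -/
theorem mean_combination {α : Type*} [MeasurableSpace α] {μ : Measure α}
    {jb ρ p2 : α → ℝ} {c T : ℝ}
    (f1i : Integrable (fun x => jb x * ρ x) μ) (f1z : ∫ x, jb x * ρ x ∂μ = 0)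
    (f2i : Integrable ρ μ) (f3i : Integrable (fun x => p2 x * ρ x) μ)
    (m2 : ∫ x, p2 x * ρ x ∂μ = T * ∫ x, ρ x ∂μ) :
    ∫ x, (jb x + c * (T - p2 x)) * ρ x ∂μ = 0 := by
  have key : ∀ x, (jb x + c * (T - p2 x)) * ρ x =
      jb x * ρ x + c * T * ρ x - c * (p2 x * ρ x) := by
    intro x; ring
  have hA : Integrable (fun x => jb x * ρ x + c * T * ρ x) μ := f1i.add (f2i.const_mul _)
  rw [integral_congr_ae (Filter.Eventually.of_forall key),
    integral_sub hA (f3i.const_mul _), integral_add f1i (f2i.const_mul _),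
    integral_const_mul, integral_const_mul, f1z, m2]
  ring

section Pinned

variable {ω₂ lam β : ℝ}

/-! ### Parity under momentum reversal -/

/-- **Parity.** For an observable `J` odd under momentum reversal, `∫ J e^{-H/T} dq dp = 0`
(`H` is even, Lebesgue measure is reversal invariant; no integrability needed). [folklore] -/
theorem pinnedChain_integral_odd_mul_gibbsDensity (ω₂ lam β γ : ℝ) (N : ℕ) (T : ℝ)
    {J : PhaseSpace N → ℝ} (hJ : ∀ x : PhaseSpace N, J (x.1, -x.2) = -J x) :
    ∫ x, J x * (pinnedChain ω₂ lam β γ).gibbsDensity N T x = 0 := by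
  have h := integral_comp_momentumReversal N fun x =>
    J x * (pinnedChain ω₂ lam β γ).gibbsDensity N T x
  simp only [hJ, OscillatorChain.gibbsDensity, OscillatorChain.hamiltonian_neg_momentum, neg_mul,
    integral_neg] at h
  simp only [OscillatorChain.gibbsDensity]
  linarith

/-- **Parity.** For `E` even and `J` odd under momentum reversal, `∫ E J e^{-H/T} dq dp = 0`.
[folklore] -/
theorem pinnedChain_integral_even_mul_odd_mul_gibbsDensity (ω₂ lam β γ : ℝ) (N : ℕ) (T : ℝ)
    {E J : PhaseSpace N → ℝ} (hE : ∀ x : PhaseSpace N, E (x.1, -x.2) = E x)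
    (hJ : ∀ x : PhaseSpace N, J (x.1, -x.2) = -J x) :
    ∫ x, E x * J x * (pinnedChain ω₂ lam β γ).gibbsDensity N T x = 0 :=
  pinnedChain_integral_odd_mul_gibbsDensity ω₂ lam β γ N T (J := fun x => E x * J x) fun x => by
    simp only [hE, hJ, mul_neg]

/-- The divergence `D_y = ∑_b ([y = b+1] j_b - [b = y] j_b)` of the bond currents is odd under
momentum reversal (each `j_b` is). [folklore] -/
theorem bondCurrentDivergence_neg_momentum (P : OscillatorChain) (N : ℕ) (y : Fin N)
    (x : PhaseSpace N) :
    (∑ b : Fin N, ((if y.val = b.val + 1 then P.bondCurrent N b (x.1, -x.2) else 0) -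
        (if b = y then P.bondCurrent N b (x.1, -x.2) else 0))) =
      -∑ b : Fin N, ((if y.val = b.val + 1 then P.bondCurrent N b x else 0) -
        (if b = y then P.bondCurrent N b x else 0)) := by
  rw [← Finset.sum_neg_distrib]
  refine Finset.sum_congr rfl fun b _ => ?_
  simp only [OscillatorChain.bondCurrent_neg_momentum]
  split_ifs <;> ring

/-- The split site energy `e_y` is even under momentum reversal. [folklore] -/
theorem splitSiteEnergy_neg_momentum (P : OscillatorChain) (N : ℕ) (y : Fin N) (x : PhaseSpace N) :
    (-x.2) y ^ 2 / 2 + P.U (x.1 y) + ∑ j : Fin N,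
        ((if j.val = y.val + 1 then P.V (x.1 j - x.1 y) / 2 else 0) +
          (if y.val = j.val + 1 then P.V (x.1 y - x.1 j) / 2 else 0)) =
      x.2 y ^ 2 / 2 + P.U (x.1 y) + ∑ j : Fin N,
        ((if j.val = y.val + 1 then P.V (x.1 j - x.1 y) / 2 else 0) +
          (if y.val = j.val + 1 then P.V (x.1 y - x.1 j) / 2 else 0)) := by
  simp

/-! ### Gaussian integration by parts in one momentum -/

/-- **Gaussian integration by parts in one momentum.** For a continuous observable `F` with
`|F| ≤ C (1 + H)` which does not depend on the momentum `p_i`: `F e^{-H/T}` and `F p_i² e^{-H/T}` are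
integrable and `∫ F p_i² e^{-H/T} = T ∫ F e^{-H/T}` (`p_i e^{-H/T} = -T ∂_{p_i} e^{-H/T}`,
`∂_{p_i} F = 0`; pinned chain, `ω₂ > 0`, `lam, β ≥ 0`, `T > 0`). In probabilistic terms: under the
Gibbs state `p_i ~ N(0,T)` is independent of the remaining coordinates. [folklore] -/
theorem pinnedChain_integral_indep_sq_momentum_mul_gibbsDensity (hω : 0 < ω₂) (hl : 0 ≤ lam)
    (hβ : 0 ≤ β) (γ : ℝ) (N : ℕ) {T : ℝ} (hT : 0 < T) (i : Fin N) {F : PhaseSpace N → ℝ}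
    (hF : Continuous F) {C : ℝ} (hC : 0 ≤ C)
    (hle : ∀ x : PhaseSpace N, |F x| ≤ C * (1 + (pinnedChain ω₂ lam β γ).hamiltonian N x))
    (hind : ∀ (x : PhaseSpace N) (t : ℝ), F (x.1, Function.update x.2 i t) = F x) :
    (Integrable fun x => F x * (pinnedChain ω₂ lam β γ).gibbsDensity N T x) ∧
    (Integrable fun x => F x * x.2 i ^ 2 * (pinnedChain ω₂ lam β γ).gibbsDensity N T x) ∧
    ∫ x, F x * x.2 i ^ 2 * (pinnedChain ω₂ lam β γ).gibbsDensity N T x =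
      T * ∫ x, F x * (pinnedChain ω₂ lam β γ).gibbsDensity N T x := by
  have hH0 : ∀ x : PhaseSpace N, 0 ≤ (pinnedChain ω₂ lam β γ).hamiltonian N x := fun x =>
    pinnedChain_hamiltonian_nonneg hω.le hl hβ γ N x
  have hp2 : ∀ x : PhaseSpace N, x.2 i ^ 2 ≤ 2 * (pinnedChain ω₂ lam β γ).hamiltonian N x :=
    fun x => pinnedChain_sq_momentum_le hω.le hl hβ γ N x i
  have iG : Integrable fun x => F x * (pinnedChain ω₂ lam β γ).gibbsDensity N T x :=
    pinnedChain_integrable_mul_gibbsDensity_of_le hω hl hβ γ N hT hF (C := C)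
      fun x => (hle x).trans (by
        nlinarith [mul_nonneg hC (hH0 x), mul_nonneg (mul_nonneg hC (hH0 x)) (hH0 x)])
  have iGp2 : Integrable fun x => F x * x.2 i ^ 2 * (pinnedChain ω₂ lam β γ).gibbsDensity N T x :=
    pinnedChain_integrable_mul_gibbsDensity_of_le hω hl hβ γ N hT (by fun_prop) (C := 2 * C)
      fun x => by
        rw [abs_mul, abs_of_nonneg (sq_nonneg (x.2 i))]
        calc |F x| * x.2 i ^ 2
            ≤ C * (1 + (pinnedChain ω₂ lam β γ).hamiltonian N x) *
                (2 * (pinnedChain ω₂ lam β γ).hamiltonian N x) :=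
              mul_le_mul (hle x) (hp2 x) (sq_nonneg _)
                (mul_nonneg hC (add_nonneg zero_le_one (hH0 x)))
          _ ≤ 2 * C * (1 + (pinnedChain ω₂ lam β γ).hamiltonian N x) ^ 2 := by
              nlinarith [mul_nonneg hC (hH0 x)]
  have iGp : Integrable fun x => F x * x.2 i * (pinnedChain ω₂ lam β γ).gibbsDensity N T x :=
    pinnedChain_integrable_mul_gibbsDensity_of_le hω hl hβ γ N hT (by fun_prop) (C := C)
      fun x => by
        rw [abs_mul]
        have hp1 : |x.2 i| ≤ 1 + (pinnedChain ω₂ lam β γ).hamiltonian N x := by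
          have hsq : |x.2 i| ≤ (1 + x.2 i ^ 2) / 2 := by
            nlinarith [sq_nonneg (|x.2 i| - 1), sq_abs (x.2 i), abs_nonneg (x.2 i)]
          linarith [hp2 x]
        calc |F x| * |x.2 i|
            ≤ C * (1 + (pinnedChain ω₂ lam β γ).hamiltonian N x) *
                (1 + (pinnedChain ω₂ lam β γ).hamiltonian N x) :=
              mul_le_mul (hle x) hp1 (abs_nonneg _)
                (mul_nonneg hC (add_nonneg zero_le_one (hH0 x)))
          _ = C * (1 + (pinnedChain ω₂ lam β γ).hamiltonian N x) ^ 2 := by ring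
  have e := integral_mul_eq_neg_of_hasLineDerivAt_of_integrable
    (F := fun x : PhaseSpace N => F x * x.2 i) (F' := fun x : PhaseSpace N => F x)
    (g := (pinnedChain ω₂ lam β γ).gibbsDensity N T)
    (g' := fun x => -(x.2 i / T) * (pinnedChain ω₂ lam β γ).gibbsDensity N T x)
    (v := ((0, Pi.single i 1) : PhaseSpace N)) iG ?_ iGp (fun x => ?_)
    (fun x => (pinnedChain ω₂ lam β γ).hasLineDerivAt_gibbsDensity
      ((pinnedChain ω₂ lam β γ).hasLineDerivAt_hamiltonian_unitP N x i))
  · have lhs : ∫ x, F x * x.2 i *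
        (-(x.2 i / T) * (pinnedChain ω₂ lam β γ).gibbsDensity N T x) =
        -T⁻¹ * ∫ x, F x * x.2 i ^ 2 * (pinnedChain ω₂ lam β γ).gibbsDensity N T x := by
      rw [← integral_const_mul]
      refine integral_congr_ae (Filter.Eventually.of_forall fun x => ?_)
      ring
    rw [lhs] at e
    refine ⟨iG, iGp2, ?_⟩
    have hTne : T ≠ 0 := hT.ne'
    calc ∫ x, F x * x.2 i ^ 2 * (pinnedChain ω₂ lam β γ).gibbsDensity N T x
        = T * (T⁻¹ * ∫ x, F x * x.2 i ^ 2 * (pinnedChain ω₂ lam β γ).gibbsDensity N T x) := by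
          rw [← mul_assoc, mul_inv_cancel₀ hTne, one_mul]
      _ = T * ∫ x, F x * (pinnedChain ω₂ lam β γ).gibbsDensity N T x := by
          congr 1
          linarith
  · refine (iGp2.const_mul (-T⁻¹)).congr (Filter.Eventually.of_forall fun x => ?_)
    ring
  · unfold HasLineDerivAt
    have h : (fun t : ℝ => (fun z : PhaseSpace N => F z * z.2 i)
        (x + t • ((0, Pi.single i 1) : PhaseSpace N))) = fun t => F x * (x.2 i + t) := by
      funext t
      have h1 : x + t • ((0, Pi.single i 1) : PhaseSpace N) =
          (x.1, Function.update x.2 i (x.2 i + t)) := by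
        rw [show x + t • ((0, Pi.single i 1) : PhaseSpace N) =
            ((x + t • ((0, Pi.single i 1) : PhaseSpace N)).1,
              (x + t • ((0, Pi.single i 1) : PhaseSpace N)).2) from rfl,
          add_smul_unitP_fst, add_smul_unitP_snd, add_smul_single_eq_update]
      simp only [h1, hind, Function.update_self]
    rw [h]
    have h1 : HasDerivAt (fun t : ℝ => x.2 i + t) 1 0 := (hasDerivAt_id' (0 : ℝ)).const_add _
    refine (h1.const_mul (F x)).congr_deriv ?_
    ring

end Pinned

end Summit.AtomisticToContinuum.FouriersLaw.Theorems.HonestZwanzig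

end
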